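import Literature.AlgebraicGeometry.Frobenioids.KummerReciprocity
import Literature.NumberTheory.GaloisRepresentations.ContinuousH1DiscreteGroup
import HarnessLib

/-!
# Frobenioids II, Def. 2.2 (ii): `H¹(H_A, μ_N(A))` — the two carriers agree

Mochizuki, *The geometry of Frobenioids II*, Kyushu J. Math. **62** (2008), §2, Def. 2.2 (ii) p. 17 and
p. 18 [cite: MochizukiFrdII2008, Def 2.2 (ii) p.17]. In the tree, the Kummer classes `κ_f` of Def. 2.1 (ii)
/ Def. 2.3 and the duality isomorphism `Kummer.DualityIso` are typed on Mathlib's abstract group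
cohomology `H1 (Rep.ofMulDistribMulAction H_A μ_N(A))` (abc-iut-L1-t4 and -t7, `KummerClass.lean`,
`KummerReciprocity.lean`), whereas condition (c) (`Kummer.IsCohSaturated`) and `F_N(A)` (`Kummer.FN`)
use Mathlib's continuous cohomology of the DISCRETE group `H_A` (`Kummer.muTopRep`). This file records
that the two first cohomology groups are the same (row L1-γ₁ of the abc-iut cell, seat
abc-iut-L2-t12; the identification abc-iut-L4-d3 asked to be stated before the cup-product
construction of `DualityIso`): `Kummer.h1MuEquiv N O HA :
H1 (Rep.ofMulDistribMulAction H_A μ_N(A)) ≃ₗ[ℤ] continuousCohomology 1 (muTopRep N O H_A)`, `[κ] ↦ [κ]`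
(`h1MuEquiv_H1π`), an instance of the generic `H1DiscreteEquiv` of
`Literature/NumberTheory/GaloisRepresentations/ContinuousH1DiscreteGroup.lean`. Nothing of [FrdII] is
asserted; nothing here concerns [IUTchIII].
-/

noncomputable section

namespace Literature.AlgebraicGeometry.Frobenioids

namespace Kummer

open CategoryTheory groupCohomology Literature.NumberTheory.GaloisRepresentations

variable {Γ : Type} [Group Γ] [TopologicalSpace Γ] [DiscreteTopology Γ]
  (N : ℕ) (O : Type) [CommMonoid O] [MulDistribMulAction Γ O] (HA : Subgroup Γ)

/-- **`H¹(H_A, μ_N(A))`, abstract = continuous**: Mathlib's group cohomology of the (discrete, in print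
finite) group `H_A` with coefficients `μ_N(A)` — the home of the Kummer classes `κ_f` (Def. 2.1 (ii))
and the domain of `Kummer.DualityIso` — is canonically the continuous cohomology of `muTopRep N O H_A`
used by condition (c) and `F_N(A)` (Def. 2.2 (ii)). [cite: MochizukiFrdII2008, Def 2.2 (ii) p.17] -/
def h1MuEquiv :
    H1 (Rep.ofMulDistribMulAction HA (Mu N O)) ≃ₗ[ℤ] continuousCohomology 1 (muTopRep N O HA) :=
  H1DiscreteEquiv (Representation.ofMulDistribMulAction HA (Mu N O))
    (discreteContRepOfRep HA (Additive (Mu N O)) (Representation.ofMulDistribMulAction HA (Mu N O)))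
    (fun _ _ => rfl)

/-- On the class of a `1`-cocycle `κ : H_A → μ_N(A)` (e.g. a Kummer cocycle `σ ↦ σ(x)/x`),
`h1MuEquiv` is the class of the same map as a continuous crossed homomorphism of the discrete `H_A`.
[cite: MochizukiFrdII2008, Def 2.2 (ii) p.17] -/
theorem h1MuEquiv_H1π (κ : cocycles₁ (Rep.ofMulDistribMulAction HA (Mu N O))) :
    h1MuEquiv N O HA (H1π _ κ) =
      oneCocycleClass (muTopRep N O HA)
        (cocycles₁ToContOneCocycles (Representation.ofMulDistribMulAction HA (Mu N O))
          (discreteContRepOfRep HA (Additive (Mu N O))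
            (Representation.ofMulDistribMulAction HA (Mu N O))) (fun _ _ => rfl) κ) :=
  H1DiscreteEquiv_H1π _ _ _ κ

/-- … and its inverse sends the class of a continuous crossed homomorphism `c : H_A → μ_N(A)` to the
class of `c` as an inhomogeneous cocycle. [cite: MochizukiFrdII2008, Def 2.2 (ii) p.17] -/
theorem h1MuEquiv_symm_oneCocycleClass (c : contOneCocycles (muTopRep N O HA)) :
    (h1MuEquiv N O HA).symm (oneCocycleClass (muTopRep N O HA) c) =
      H1π (Rep.ofMulDistribMulAction HA (Mu N O))
        (contOneCocyclesToCocycles₁ (Representation.ofMulDistribMulAction HA (Mu N O))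
          (discreteContRepOfRep HA (Additive (Mu N O))
            (Representation.ofMulDistribMulAction HA (Mu N O))) (fun _ _ => rfl) c) :=
  H1DiscreteEquiv_symm_oneCocycleClass _ _ _ c

end Kummer

end Literature.AlgebraicGeometry.Frobenioids
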